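import Summits.Ventures.CertifiedManyBodySolver.Certificates.HubbardSquare_transportClosure_KitLaws
import HarnessLib

/-!
# Ventures/CertifiedManyBodySolver — Certificates/HubbardSquare_transportClosure_KitL.lean
# (hubbard-fast-reuse-1 g2, cell hubbard-fast, D-0154 (A) CERTIFICATE REUSE: the TRANSPORT-CLOSURE kit, part 4 = the LEFTWARD `U`-secant cap)

One more generic one-step TRANSPORT adapter in the shape of `HubbardSquare_transportClosure_KitLaws` (surrogate-1
`_mlword_Icc` contract, `θ = ![U/t, t'/t, n]`, floor/cap = 8 literal coefficients): the LEFTWARD `U`-secant-extension CAP.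
`KitLaws.tc_mlCap_Usecx` extends a cap at `U₁` to the RIGHT (`θ0 ≥ U₁`) with an UPPER slope bound; this file extends a cap
at `U₀` to the LEFT (`0 ≤ θ0 ≤ U₀`) with a LOWER slope bound read off a floor further right: by concavity of `U ↦ e₀` (a
consequence of the joint concavity `energyDensityTT'_ge_convexComb`), for `θ0 < U₀ < U₁` the slope of `e₀` on `[θ0, U₀]`
is at least its slope on `[U₀, U₁]`, which is at least `(F(U₁) - C(U₀))/(U₁ - U₀) ≥ S`; hence
`e₀(θ0) ≤ C(U₀) - (U₀ - θ0)·S`. When `S > 0` this is strictly below the monotone carry `e₀(θ0) ≤ C(U₀)`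
(`tc_mlCap_Umono_below`); when `S ≤ 0` the carry is better and the consumer should use it instead (the lemma holds either way).
Use (reuse-1 g2's generator `emit_tc2`, law tag `UsecxL`): caps just LEFT of the lowest certified `U`-column of a box
(e.g. the `U < 7/2` corners of the Hg / Tl hulls) from the cap at that column and any floor at a larger `U`.
HONEST FRAMING: a bookkeeping adapter; certifies nothing by itself; every consumer word inherits exactly the hypotheses of the
words it cites; no number of record; not a phase word; no summit statement is proved here; not a superconductivity verdict.
-/

namespace Summit.Ventures.CertifiedManyBodySolver.Certificates

open Literature.MathematicalPhysics.QuantumLattice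
open Literature.MathematicalPhysics.QuantumLattice.ThermodynamicLimit
open Set

/-- **LEFTWARD `U`-SECANT-EXTENSION CAP** (concavity of `e₀` in `U` on `U ≥ 0`): a bilinear cap `e(·,U₀,·) ≤ B` and a
bilinear floor `A ≤ e(·,U₁,·)` with `U₀ < U₁` bound the left slope at `U₀` from BELOW by any `S` with
`(U₁-U₀)·S ≤ A - B` at the four `(t',n)` corners, whence `e(θ) ≤ B(θ1,θ2) - (U₀-θ0)·S` for `0 ≤ θ0 ≤ U₀`: a cap in the
8-coefficient shape (`(β₀ - U₀S) + S·θ0 + β₁θ1 + β₂θ2 + β₃θ1θ2`). [cite: Israel1979, Thm. I.3.4] -/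
theorem tc_mlCap_UsecxL (t : ℝ) {U₀ U₁ Ua Ub s₁ s₂ n₁ n₂ S α₀ α₁ α₂ α₃ β₀ β₁ β₂ β₃ : ℝ}
    (hUa : 0 ≤ Ua) (hb : Ub ≤ U₀) (hU : U₀ < U₁) (hn₁ : 0 ≤ n₁) (hn₂ : n₂ < 2)
    (hB : ∀ s n : ℝ, s₁ ≤ s → s ≤ s₂ → n₁ ≤ n → n ≤ n₂ →
      energyDensityTT' t s U₀ n ≤ β₀ + β₁ * s + β₂ * n + β₃ * s * n)
    (hA : ∀ s n : ℝ, s₁ ≤ s → s ≤ s₂ → n₁ ≤ n → n ≤ n₂ →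
      α₀ + α₁ * s + α₂ * n + α₃ * s * n ≤ energyDensityTT' t s U₁ n)
    (w₁₁ : (U₁ - U₀) * S ≤ (α₀ + α₁ * s₁ + α₂ * n₁ + α₃ * s₁ * n₁) - (β₀ + β₁ * s₁ + β₂ * n₁ + β₃ * s₁ * n₁))
    (w₁₂ : (U₁ - U₀) * S ≤ (α₀ + α₁ * s₁ + α₂ * n₂ + α₃ * s₁ * n₂) - (β₀ + β₁ * s₁ + β₂ * n₂ + β₃ * s₁ * n₂))
    (w₂₁ : (U₁ - U₀) * S ≤ (α₀ + α₁ * s₂ + α₂ * n₁ + α₃ * s₂ * n₁) - (β₀ + β₁ * s₂ + β₂ * n₁ + β₃ * s₂ * n₁))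
    (w₂₂ : (U₁ - U₀) * S ≤ (α₀ + α₁ * s₂ + α₂ * n₂ + α₃ * s₂ * n₂) - (β₀ + β₁ * s₂ + β₂ * n₂ + β₃ * s₂ * n₂)) :
    ∀ θ ∈ Set.Icc (![Ua, s₁, n₁] : Fin 3 → ℝ) ![Ub, s₂, n₂],
      energyDensityTT' t (θ 1) (θ 0) (θ 2) ≤ (β₀ - U₀ * S) + S * θ 0 + β₁ * θ 1 + β₂ * θ 2 + 0 * θ 0 * θ 1 +
        0 * θ 0 * θ 2 + β₃ * θ 1 * θ 2 + 0 * θ 0 * θ 1 * θ 2 := by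
  intro θ hθ
  obtain ⟨⟨k1, k2⟩, ⟨k3, k4⟩, ⟨k5, k6⟩⟩ := mem_Icc_vec3_iff.1 hθ
  have hn0 : 0 ≤ θ 2 := hn₁.trans k5
  have hn2 : θ 2 < 2 := lt_of_le_of_lt k6 hn₂
  have h0θ : 0 ≤ θ 0 := hUa.trans k1
  have hθU₀ : θ 0 ≤ U₀ := k2.trans hb
  have hA' := hA (θ 1) (θ 2) k3 k4 k5 k6
  have hB' := hB (θ 1) (θ 2) k3 k4 k5 k6
  have hw : 0 ≤ ((α₀ - β₀) - (U₁ - U₀) * S) + (α₁ - β₁) * θ 1 + (α₂ - β₂) * θ 2 +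
      (α₃ - β₃) * θ 1 * θ 2 :=
    bilinear_nonneg_on_rect k3 k4 k5 k6 (by linear_combination w₁₁) (by linear_combination w₁₂)
      (by linear_combination w₂₁) (by linear_combination w₂₂)
  rcases eq_or_lt_of_le hθU₀ with h0 | h0
  · rw [h0]
    linear_combination hB'
  · have hd : 0 < U₁ - θ 0 := by linarith
    have hd0 : U₁ - θ 0 ≠ 0 := hd.ne'
    set a : ℝ := (U₁ - U₀) / (U₁ - θ 0) with ha_def
    set b : ℝ := (U₀ - θ 0) / (U₁ - θ 0) with hb_def
    have ha0 : 0 ≤ a := div_nonneg (by linarith) hd.le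
    have hb0 : 0 ≤ b := div_nonneg (by linarith) hd.le
    have hda : (U₁ - θ 0) * a = U₁ - U₀ := by rw [ha_def]; field_simp
    have hdb : (U₁ - θ 0) * b = U₀ - θ 0 := by rw [hb_def]; field_simp
    have hab : a + b = 1 := by
      have h1 : (U₁ - θ 0) * (a + b) = (U₁ - θ 0) * 1 := by rw [mul_add, hda, hdb]; ring
      exact mul_left_cancel₀ hd0 h1
    have hc := energyDensityTT'_ge_convexComb t hn0 hn2 h0θ (by linarith : (0 : ℝ) ≤ U₁) ha0 hb0 hab
      (le_refl (energyDensityTT' t (θ 1) (θ 0) (θ 2))) hA'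
    have es : a * θ 1 + b * θ 1 = θ 1 := by rw [← add_mul, hab, one_mul]
    have eu : a * θ 0 + b * U₁ = U₀ := by
      have h1 : (U₁ - θ 0) * (a * θ 0 + b * U₁) = (U₁ - θ 0) * U₀ := by
        rw [mul_add, ← mul_assoc, ← mul_assoc, hda, hdb]; ring
      exact mul_left_cancel₀ hd0 h1
    rw [es, eu] at hc
    have h1 := hc.trans hB'
    have h2 : (U₁ - U₀) * energyDensityTT' t (θ 1) (θ 0) (θ 2) +
        (U₀ - θ 0) * (α₀ + α₁ * θ 1 + α₂ * θ 2 + α₃ * θ 1 * θ 2) ≤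
        (U₁ - θ 0) * (β₀ + β₁ * θ 1 + β₂ * θ 2 + β₃ * θ 1 * θ 2) := by
      have h3 := mul_le_mul_of_nonneg_left h1 hd.le
      rw [mul_add, ← mul_assoc, ← mul_assoc, hda, hdb] at h3
      exact h3
    have h3 : (U₀ - θ 0) * ((U₁ - U₀) * S) ≤ (U₀ - θ 0) * ((α₀ + α₁ * θ 1 + α₂ * θ 2 + α₃ * θ 1 * θ 2) -
        (β₀ + β₁ * θ 1 + β₂ * θ 2 + β₃ * θ 1 * θ 2)) :=
      mul_le_mul_of_nonneg_left (by linear_combination hw) (by linarith)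
    have hdU : 0 < U₁ - U₀ := sub_pos.2 hU
    have h4 : (U₁ - U₀) * energyDensityTT' t (θ 1) (θ 0) (θ 2) ≤
        (U₁ - U₀) * ((β₀ - U₀ * S) + S * θ 0 + β₁ * θ 1 + β₂ * θ 2 + 0 * θ 0 * θ 1 +
          0 * θ 0 * θ 2 + β₃ * θ 1 * θ 2 + 0 * θ 0 * θ 1 * θ 2) := by
      linear_combination h2 + h3
    exact le_of_mul_le_mul_left h4 hdU

end Summit.Ventures.CertifiedManyBodySolver.Certificates
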